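import Summits.Ventures.Crystal3D.Theorems.StickyWulffConstantCoaxialWallLawSeamPiece
import Summits.Ventures.Crystal3D.Theorems.StickyWulffConstantCoaxialWallLawSeamMultiPieceSplit
import HarnessLib

/-!
# THE MULTI-PIECE ASSEMBLY WITHOUT A SEAM TERM: `Σ_A(Y, z) ≤ Σ_{pieces} capSummand` (crux `CoaxialWallLaw`, stmt-Ventures-19481; line `WallLedgerF`,
# skeleton 'CoaxialWallLawCertificates' v8.1, stub `stub_incoherentSeamSmall`; F-TAIL-g12 §7 step 5)

HONEST FRAMING. Venture `Summits/Ventures/Crystal3D` (cell `crystal3d-full`); the census-free half of the multi-piece architecture for lane F's T5b, assembled: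
every (A)-pair ending within `1` of the payer descends to an exact PIECE in the payer window ('…SeamPiece.exists_pieceOf_of_isEndPairA'), so the multi-piece split
('…SeamMultiPieceSplit') has NO residual, and each piece's lowered pools are eroded by at most the junk cap table ('…SeamClosedCoreCapTable.JunkCapBoundClosed').
What is NOT here (the remaining inputs, named in the docstrings): a CERTIFICATE bounding the lowered summand of a coherent piece at an internal-or-external payer
(cf-p2), and the CROWDING bound on how the pieces around one payer add up.  Nothing about the stubs is claimed; F-C1 not moved.
* `pieceChoice`, `pieceFamily Y z v S₁ S₂` — one piece per (A)-pair ending within `1` of `z` (by choice from `exists_pieceOf_of_isEndPairA`); `pieceFamily_spec`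
  (each member is `pieceOf Y z c S` with `c ∈ Y`, `dist z c ≤ 2`), `isCapClosed_of_mem_pieceFamily`, `restPieceMultA_pieceFamily_eq_zero` (NO residual);
* `capPool_le_loweredPool_of_closed` — erosion control: `capPool cap E b ≤ loweredPool Y E b` for a cap-closed `E`, `b` within `1` of `z`, under `JunkCapBoundClosed cap`;
  `coreTerm_le_capSummand_of_closed`;
* **`localSummandA_le_sum_pieceFamily_coreTerm`** — `Σ_A(Y, z) ≤ Σ_{E ∈ pieceFamily} coreTerm Y E z` (lowered pools positive);
* **`localSummandA_le_sum_pieceFamily_capSummand`** — `Σ_A(Y, z) ≤ Σ_{E ∈ pieceFamily} capSummand cap E z` under `JunkCapBoundClosed cap` and positivity of the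
  capped pools — the form a per-piece certificate + a crowding bound close.
-/

noncomputable section

namespace Summit.Ventures.Crystal3D.Theorems

namespace TailResidue

open Summit.Ventures.Crystal3D Finset
open scoped InnerProductSpace

section Family

variable {Y : Finset (EuclideanSpace ℝ (Fin 3))} (hY : ∀ p ∈ Y, ∀ p' ∈ Y, p ≠ p' → 1 ≤ dist p p') {v : WordVersion} {S₁ S₂ : PlateSystem}
  (h₁ : S₁.RT ⊆ fccSlots) (h₂ : S₂.RT ⊆ fccSlots) (z : EuclideanSpace ℝ (Fin 3))

open scoped Classical in
/-- The piece CHOSEN for the pair `(b, q)`: a `pieceOf Y z c S` to which the pair descends (`∅` if `(b, q)` is not an (A)-pair ending within `1` of `z`). -/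
def pieceChoice (Y : Finset (EuclideanSpace ℝ (Fin 3))) (hY : ∀ p ∈ Y, ∀ p' ∈ Y, p ≠ p' → 1 ≤ dist p p') (v : WordVersion) {S₁ S₂ : PlateSystem}
    (h₁ : S₁.RT ⊆ fccSlots) (h₂ : S₂.RT ⊆ fccSlots) (z : EuclideanSpace ℝ (Fin 3)) (bq : EuclideanSpace ℝ (Fin 3) × EuclideanSpace ℝ (Fin 3)) :
    Finset (EuclideanSpace ℝ (Fin 3)) :=
  if h : dist z bq.1 ≤ 1 ∧ IsEndPairA Y v S₁ S₂ bq.1 bq.2 then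
    pieceOf Y z (exists_pieceOf_of_isEndPairA hY h₁ h₂ h.1 h.2).choose (exists_pieceOf_of_isEndPairA hY h₁ h₂ h.1 h.2).choose_spec.choose
  else ∅

open scoped Classical in
/-- **THE PIECE FAMILY of the payer `z`**: one chosen piece per (A)-end pair `(b, q)` of `Y` with `b` within `1` of `z`. -/
def pieceFamily (Y : Finset (EuclideanSpace ℝ (Fin 3))) (hY : ∀ p ∈ Y, ∀ p' ∈ Y, p ≠ p' → 1 ≤ dist p p') (v : WordVersion) {S₁ S₂ : PlateSystem}
    (h₁ : S₁.RT ⊆ fccSlots) (h₂ : S₂.RT ⊆ fccSlots) (z : EuclideanSpace ℝ (Fin 3)) : Finset (Finset (EuclideanSpace ℝ (Fin 3))) :=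
  ((Y ×ˢ Y).filter fun bq => dist z bq.1 ≤ 1 ∧ IsEndPairA Y v S₁ S₂ bq.1 bq.2).image (pieceChoice Y hY v h₁ h₂ z)

open scoped Classical in
/-- The chosen piece of an actual pair: it is `pieceOf Y z c S` with `c ∈ {q, b}`, and the pair descends to it. -/
theorem pieceChoice_spec {b q : EuclideanSpace ℝ (Fin 3)} (hzb : dist z b ≤ 1) (hp : IsEndPairA Y v S₁ S₂ b q) :
    ∃ c : EuclideanSpace ℝ (Fin 3), ∃ S : EuclideanSpace ℝ (Fin 3) ≃ₗᵢ[ℝ] EuclideanSpace ℝ (Fin 3),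
      (c = q ∨ c = b) ∧ pieceChoice Y hY v h₁ h₂ z (b, q) = pieceOf Y z c S ∧ IsEndPairA (pieceOf Y z c S) v S₁ S₂ b q := by
  have h : dist z (b, q).1 ≤ 1 ∧ IsEndPairA Y v S₁ S₂ (b, q).1 (b, q).2 := ⟨hzb, hp⟩
  unfold pieceChoice
  rw [dif_pos h]
  exact ⟨_, _, (exists_pieceOf_of_isEndPairA hY h₁ h₂ h.1 h.2).choose_spec.choose_spec.1, rfl,
    (exists_pieceOf_of_isEndPairA hY h₁ h₂ h.1 h.2).choose_spec.choose_spec.2⟩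

open scoped Classical in
/-- **Members of the family are pieces with origin in `Y` within `2` of the payer.** -/
theorem pieceFamily_spec {E : Finset (EuclideanSpace ℝ (Fin 3))} (hE : E ∈ pieceFamily Y hY v h₁ h₂ z) :
    ∃ c ∈ Y, ∃ S : EuclideanSpace ℝ (Fin 3) ≃ₗᵢ[ℝ] EuclideanSpace ℝ (Fin 3), dist z c ≤ 2 ∧ E = pieceOf Y z c S := by
  obtain ⟨⟨b, q⟩, hbq, rfl⟩ := mem_image.1 hE
  obtain ⟨-, hzb, hp⟩ := mem_filter.1 hbq
  dsimp only at hzb hp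
  obtain ⟨c, S, hc, hE, hpE⟩ := pieceChoice_spec hY h₁ h₂ z hzb hp
  have hq : q ∈ Y := hp.1
  have hb : b ∈ Y := hp.2.1
  -- `dist b q = 1` for an (A)-pair (the mover arrives from distance `1`)
  have hdbq : dist b q = 1 := by
    obtain ⟨-, -, -, G, d, hadm, -, hmove⟩ := hp
    obtain ⟨⟨u, hu, hdu⟩, -⟩ : (∃ u ∈ fccSlots, d = G u) ∧ (∃ u ∈ fccSlots, -d = G u) := by
      rcases hadm with h | h
      · exact exists_slots_of_adm h₁ h
      · exact exists_slots_of_adm h₂ h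
    rcases hmove with ⟨-, hbq', -⟩ | ⟨m, htw, -, hbq', -⟩
    · rw [hbq', hdu, dist_comm]; exact dist_slotSite_eq_one G _ hu
    · have hm1 : ‖m‖ = 1 := htw.1.1
      rw [hbq', dist_eq_norm, show q - (d - (2 * ⟪d, m⟫_ℝ) • m) - q = -((ℝ ∙ m)ᗮ.reflection d) by rw [reflection_unit_apply hm1]; abel, norm_neg,
        LinearIsometryEquiv.norm_map, hdu, LinearIsometryEquiv.norm_map, norm_eq_one_of_mem_fccSlots hu]
  rcases hc with hc | hc
  · exact ⟨c, by rw [hc]; exact hq, S, by rw [hc]; linarith [dist_triangle z b q], hE⟩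
  · exact ⟨c, by rw [hc]; exact hb, S, by rw [hc]; linarith, hE⟩

open scoped Classical in
/-- Members of the family are cap-closed in the payer window. -/
theorem isCapClosed_of_mem_pieceFamily {E : Finset (EuclideanSpace ℝ (Fin 3))} (hE : E ∈ pieceFamily Y hY v h₁ h₂ z) : IsCapClosed Y z E := by
  obtain ⟨c, -, S, -, rfl⟩ := pieceFamily_spec hY h₁ h₂ z hE
  exact isCapClosed_pieceOf Y z c S

open scoped Classical in
/-- **NO RESIDUAL**: every (A)-pair ending within `1` of the payer descends to a member of the family. -/
theorem restPieceMultA_pieceFamily_eq_zero {b : EuclideanSpace ℝ (Fin 3)} (hzb : dist z b ≤ 1) : restPieceMultA Y v S₁ S₂ (pieceFamily Y hY v h₁ h₂ z) b = 0 := by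
  unfold restPieceMultA
  rw [card_eq_zero, eq_empty_iff_forall_notMem]
  intro q hq
  obtain ⟨hqY, hp, hno⟩ := mem_filter.1 hq
  obtain ⟨c, S, -, hE, hpE⟩ := pieceChoice_spec hY h₁ h₂ z hzb hp
  refine hno _ (mem_image.2 ⟨(b, q), mem_filter.2 ⟨mem_product.2 ⟨hp.2.1, hqY⟩, hzb, hp⟩, rfl⟩) ?_
  rw [hE]; exact hpE

open scoped Classical in
/-- **`Σ_A(Y, z) ≤ Σ_{E ∈ pieceFamily} coreTerm Y E z`** (lowered pools of the pieces positive at their loaded balls within `1` of `z`). -/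
theorem localSummandA_le_sum_pieceFamily_coreTerm
    (hpos : ∀ E ∈ pieceFamily Y hY v h₁ h₂ z, ∀ b ∈ E, dist z b ≤ 1 → 0 < endMultA E v S₁ S₂ b → 0 < loweredPool Y E b) :
    localSummandA v S₁ S₂ Y z ≤ ∑ E ∈ pieceFamily Y hY v h₁ h₂ z, coreTerm Y E v S₁ S₂ z := by
  have h := localSummandA_le_sum_coreTerms_add_restPiece (v := v) (S₁ := S₁) (S₂ := S₂) hY z (pieceFamily Y hY v h₁ h₂ z)
    (fun E hE => by obtain ⟨c, -, S, -, rfl⟩ := pieceFamily_spec hY h₁ h₂ z hE; exact pieceOf_subset Y z c S) hpos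
  have hzero : ∑ b ∈ Y.filter (fun b => dist z b ≤ 1 ∧ 0 < restPieceMultA Y v S₁ S₂ (pieceFamily Y hY v h₁ h₂ z) b),
      (restPieceMultA Y v S₁ S₂ (pieceFamily Y hY v h₁ h₂ z) b : ℝ) / pooledDef Y b = 0 := by
    refine sum_eq_zero fun b hb => ?_
    obtain ⟨-, hzb, hr⟩ := mem_filter.1 hb
    rw [restPieceMultA_pieceFamily_eq_zero hY h₁ h₂ z hzb] at hr
    exact absurd hr (lt_irrefl 0)
  linarith

end Family

/-! ### Erosion control for cap-closed cores and the capped form -/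

section Capped

variable (cap : Finset (EuclideanSpace ℝ (Fin 3)) → EuclideanSpace ℝ (Fin 3) → ℕ)

open scoped Classical in
/-- **Erosion control**: for a cap-closed core `E` and `b` within `1` of the payer, `capPool cap E b ≤ loweredPool Y E b` under `JunkCapBoundClosed cap` (the healing
contacts onto the core balls within `1` of `b` — all within `2` of `z` — number at most their capacities; the foreign deficiency term is non-negative). -/
theorem capPool_le_loweredPool_of_closed {Y E : Finset (EuclideanSpace ℝ (Fin 3))} (hY : ∀ p ∈ Y, ∀ q ∈ Y, p ≠ q → 1 ≤ dist p q) {z : EuclideanSpace ℝ (Fin 3)}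
    (hD : IsCapClosed Y z E) (hcap : JunkCapBoundClosed cap) {b : EuclideanSpace ℝ (Fin 3)} (hzb : dist z b ≤ 1) : capPool cap E b ≤ loweredPool Y E b := by
  have hsplit : (((E.filter fun y => dist b y ≤ 1) ×ˢ (Y \ E)).filter fun p => dist p.1 p.2 = 1).card =
      ∑ y ∈ E.filter (fun y => dist b y ≤ 1), ((Y \ E).filter fun x => dist y x = 1).card := by
    rw [card_filter, sum_product]
    refine sum_congr rfl fun y _ => ?_
    rw [card_filter]
  have hheal : ((((E.filter fun y => dist b y ≤ 1) ×ˢ (Y \ E)).filter fun p => dist p.1 p.2 = 1).card : ℝ) ≤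
      ∑ y ∈ E.filter (fun y => dist b y ≤ 1), (cap E y : ℝ) := by
    push_cast [hsplit]
    refine sum_le_sum fun y hy => ?_
    obtain ⟨hyE, hby⟩ := mem_filter.1 hy
    exact_mod_cast hcap Y hY z E hD y hyE (by linarith [dist_triangle z b y])
  have hdefnn : 0 ≤ ∑ x ∈ (Y \ E).filter (fun x => dist b x ≤ 1 ∧ (Y.filter fun q => dist x q = 1).card ≤ 11),
      ((12 : ℝ) - ((Y.filter fun q => dist x q = 1).card : ℝ)) := by
    refine sum_nonneg fun x hx => ?_
    have h11 := (mem_filter.1 hx).2.2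
    have : ((Y.filter fun q => dist x q = 1).card : ℝ) ≤ 11 := by exact_mod_cast h11
    linarith
  unfold capPool loweredPool
  linarith

open scoped Classical in
/-- **Core term ≤ capped summand** for a cap-closed core under `JunkCapBoundClosed cap` and positivity of the capped pools. -/
theorem coreTerm_le_capSummand_of_closed {Y E : Finset (EuclideanSpace ℝ (Fin 3))} (hY : ∀ p ∈ Y, ∀ q ∈ Y, p ≠ q → 1 ≤ dist p q) {z : EuclideanSpace ℝ (Fin 3)}
    (hD : IsCapClosed Y z E) (hcap : JunkCapBoundClosed cap) (v : WordVersion) (S₁ S₂ : PlateSystem)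
    (hpos : ∀ b ∈ E, dist z b ≤ 1 → 0 < endMultA E v S₁ S₂ b → 0 < capPool cap E b) :
    coreTerm Y E v S₁ S₂ z ≤ capSummand cap v S₁ S₂ E z := by
  unfold coreTerm capSummand
  refine sum_le_sum fun b hb => ?_
  obtain ⟨hbE, hzb, he⟩ := mem_filter.1 hb
  exact div_le_div_of_nonneg_left (Nat.cast_nonneg _) (hpos b hbE hzb he) (capPool_le_loweredPool_of_closed cap hY hD hcap hzb)

open scoped Classical in
/-- **`Σ_A(Y, z) ≤ Σ_{E ∈ pieceFamily} capSummand cap E z`** — the multi-piece assembly with NO seam term: what remains to bound is the capped summand of each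
piece (a certificate over coherent pieces at an internal or external payer) and how the pieces around one payer add up (crowding). -/
theorem localSummandA_le_sum_pieceFamily_capSummand {Y : Finset (EuclideanSpace ℝ (Fin 3))} (hY : ∀ p ∈ Y, ∀ p' ∈ Y, p ≠ p' → 1 ≤ dist p p')
    {v : WordVersion} {S₁ S₂ : PlateSystem} (h₁ : S₁.RT ⊆ fccSlots) (h₂ : S₂.RT ⊆ fccSlots) (z : EuclideanSpace ℝ (Fin 3)) (hcap : JunkCapBoundClosed cap)
    (hpos : ∀ E ∈ pieceFamily Y hY v h₁ h₂ z, ∀ b ∈ E, dist z b ≤ 1 → 0 < endMultA E v S₁ S₂ b → 0 < capPool cap E b) :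
    localSummandA v S₁ S₂ Y z ≤ ∑ E ∈ pieceFamily Y hY v h₁ h₂ z, capSummand cap v S₁ S₂ E z := by
  classical
  have hpos' : ∀ E ∈ pieceFamily Y hY v h₁ h₂ z, ∀ b ∈ E, dist z b ≤ 1 → 0 < endMultA E v S₁ S₂ b → 0 < loweredPool Y E b :=
    fun E hE b hb hzb he => lt_of_lt_of_le (hpos E hE b hb hzb he)
      (capPool_le_loweredPool_of_closed cap hY (isCapClosed_of_mem_pieceFamily hY h₁ h₂ z hE) hcap hzb)
  refine (localSummandA_le_sum_pieceFamily_coreTerm hY h₁ h₂ z hpos').trans (sum_le_sum fun E hE => ?_)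
  exact coreTerm_le_capSummand_of_closed cap hY (isCapClosed_of_mem_pieceFamily hY h₁ h₂ z hE) hcap v S₁ S₂ (hpos E hE)

end Capped

end TailResidue

end Summit.Ventures.Crystal3D.Theorems

end
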